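import Summits.BirchSwinnertonDyer.BirchSwinnertonDyer.Theorems.EisensteinPrimesBSDpOnCellCTelescopeK2ControlOfFrobeniusData
import Summits.BirchSwinnertonDyer.BirchSwinnertonDyer.Theorems.EisensteinPrimesBSDpOnCellCTelescopeK2WeightTwoControlMapOfInert
import Literature.NumberTheory.EllipticCurves.AnticyclotomicHeegnerPlacesDecompositionProofs
import HarnessLib

/-!
# Crux 4 `BSDpOnCellC` (stmt-BirchSwinnertonDyer-19034), line `telescope`, leaf N2 (`stub_weightTwoControlOfPub`, v10): SUB-LEAF W2
# `stub_weightTwoControlMap` FROM N1's FIBRE DATA + (split) + FROBENIUS ANNIHILATORS AT THE BAD PRIMES OF DEGREE ONE — the inertia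
# clause (inert) of `…WeightTwoControlMapOfInert` (p749092) REMOVED (helper, `--supports stmt-BirchSwinnertonDyer-19034 --as helper`;
# closes nothing; NOT the registered text)

Cell `bsd-eis`, width seat `bsd-line-x2-p2` (prover g19, 2026-08-29; D-0154 KEY row 5). THEOREMS ONLY: no definition, no named
fact, no `sorry`, no instance, no notation. Repair (R2) of memo `W2-BINDERS-x2p2g19.md` (evidence #52 on -19034) carried to the end:
`TelescopeK2ControlOfFrobeniusData.exists_quotSMulTop_XBig_linearMap_of_frobeniusData` (this seat, the refined `D_w`-control) at
`(κ, ρ₂, 𝔭bar, ∅, c = X)` with every hypothesis discharged from N1-SHAPED data (tor)/(cof₀)/(unr)/(fd₀), EXCEPT: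

* (split) `W.HasSplitMultiplicativeReductionAtPrime p` (as in p749092: the finite fixed `p`-power torsion at `𝔭bar` is in the tree
  by bsd-stepL's Tate-uniformisation chain in the SPLIT case only);
* (deg₁) every `w ∈ S₀` with `w ∤ p` has residue degree one and is unramified over `ℚ` (on Cell C with the Heegner hypothesis every
  `ℓ ∣ N` splits in `K`) — then `w` is finitely decomposed in `K_∞` (Brink 2007 Thm. 2, tree
  `ZpExtension.decomp_not_le_kerSubgroup_of_isAnticyclotomic_anyPrime`) and some `d ∈ Γ_{K_w}` has `κ(res d) = p^s`, `s ≥ 0`;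
* (ann) for every `w ∈ S₀` with `w ∤ p` and EVERY `d ∈ Γ_{K_w}`, a MONIC `P ∈ ℤ_p⟦X⟧[Y]` with `P(ρ₂(res d)) · A₂^{I_w} ⊆ X · A₂^{I_w}`
  (classically: `A₂^{I_w}/X·A₂^{I_w} ↪ H¹(I_w, A₂[X])`, a cofinitely generated `ℤ_p`-module on which `d` acts; Cayley–Hamilton).

What is discharged HERE (§1): in a `ℤ_p⟦X⟧`-module finite additive order ⇒ `p`-primary (so (hrootsI) is free); the reduction of
`aeval` along `PowerSeries.map π`; `P((1+T)^N) ≠ 0` for `P` monic, `N ≥ 1` over a domain; hence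
`C c ∤ C x · ∏ P_i((1+T)^{N_i})` whenever some `π : 𝒪 → k` (domain) kills `c` but not `x` — at `(ℤ_p⟦X⟧, X, p^a, constantCoeff)` this is
(hnd); and the local image `κ(Γ_{K_w}) ∋ p^s` at a degree-one `w ∤ p` (Brink + the tree's closed-subgroup lemma).

* **`exists_weightTwoControlMap_of_frobenius_of_split`** — THE STATEMENT: for `K` imaginary quadratic, `p ≠ 2`, `κ` anticyclotomic,
  `𝔭bar ∋ p` of degree one, `E = W/ℚ` split multiplicative at `p`, `ρ₂ : Γ_K → Aut_{ℤ_p⟦X⟧}(A₂)` with (tor), (cof₀), (unr `S₀`, a finset),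
  (fd₀ `θ₀`, finite kernel), (deg₁), (ann): `∃ α : QuotSMulTop (C X) (XBig κ ρ₂ 𝔭bar ∅) →ₗ[ℤ_p⟦X⟧⟦T⟧] CharacterModule ↥(Sel(M₂[C X]))`,
  kernel killed elementwise by scalars prime to `C X`, cokernel FINITE — the conclusion of `K2Weight2.stub_weightTwoControlMap`
  for these objects, token-shape (same conclusion text as p749092).
* `exists_weightTwoControlMap_of_frobenius_of_heegner` — the same with (deg₁) discharged from `SatisfiesHeegnerHypothesis N₀ K` and
  «the bad primes away from `p` divide `N₀`» (tree `ramificationIdx_eq_one_and_inertiaDeg_eq_one_of_natCast_mem_of_satisfiesHeegnerHypothesis`).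

HONEST FRAMING: W2's conclusion at the object level under (split) + (deg₁) + (ann) in place of the road prefix; (ann) and (deg₁) are
classical but NOT proved here; the branch lattice `ρ₂` is a binder, not constructed; nothing about any curve's BSD is proved; no
registered stub, crux or summit statement is proved by this file; closes: none.

References: [Castella2018Erratum] Lemma 2.1 (p. 2); [JetchevSkinnerWan2017] §3.4, Lemma 3.4.1 (arXiv:1512.06894 p. 14); [Ochiai2006]
Prop. 5.1 (Compositio 142 p. 1177); [GreenbergVatsal2000] Prop. 2.4; [Brink2007] Thm. 2 (pp. 2134–2135) and Cor. 1 (p. 2136);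
[Washington1997] §13.1; [Gross1991] §1.
-/

noncomputable section

-- D-0017: single-problem summit, the namespace repeats the problem name by design.
set_option linter.dupNamespace false
set_option autoImplicit false

open Field IsDedekindDomain NumberField WeierstrassCurve
open Literature.NumberTheory.GaloisRepresentations Literature.NumberTheory.EllipticCurves
  Literature.NumberTheory.EllipticCurves.BigRepModule Literature.NumberTheory.EllipticCurves.BigGaloisRep
open Summit.BirchSwinnertonDyer.Rank1Residual.X11b

namespace Summit.BirchSwinnertonDyer.BirchSwinnertonDyer.Theorems.TelescopeK2WeightTwoControlMapOfFrobenius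

/-! ## §1 Algebraic inputs -/

/-- **In a `ℤ_p⟦X⟧`-module an element of finite additive order is `p`-primary**: if `n • a = 0`, `n = p^j m`, `p ∤ m`, then `m` is a
unit of `ℤ_p⟦X⟧` (its constant coefficient is a `p`-adic unit) and `p^j • a = 0`. [folklore] [cite: Washington1997, §13.1] -/
theorem exists_pow_smul_eq_zero_of_isOfFinAddOrder {p : ℕ} [Fact p.Prime] {A : Type*} [AddCommGroup A]
    [Module (PowerSeries ℤ_[p]) A] {a : A} (ha : IsOfFinAddOrder a) : ∃ k : ℕ, p ^ k • a = 0 := by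
  have hp : p.Prime := Fact.out
  obtain ⟨n, hnpos, hn⟩ := (isOfFinAddOrder_iff_nsmul_eq_zero).1 ha
  obtain ⟨j, m, hpm, hnjm⟩ := Nat.exists_eq_pow_mul_and_not_dvd hnpos.ne' p hp.one_lt.ne'
  -- `m` is a unit of `ℤ_p⟦X⟧`
  have hmu : IsUnit ((m : ℕ) : PowerSeries ℤ_[p]) := by
    rw [PowerSeries.isUnit_iff_constantCoeff, map_natCast, PadicInt.isUnit_iff]
    refine le_antisymm (PadicInt.norm_le_one _) (not_lt.1 fun hlt => hpm ?_)
    rw [← Int.cast_natCast, PadicInt.norm_int_lt_one_iff_dvd] at hlt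
    exact_mod_cast hlt
  obtain ⟨u, hu⟩ := hmu
  refine ⟨j, ?_⟩
  have h1 : ((p ^ j * m : ℕ) : PowerSeries ℤ_[p]) • a = 0 := by
    rw [Nat.cast_smul_eq_nsmul, ← hnjm, hn]
  calc p ^ j • a = ((p ^ j : ℕ) : PowerSeries ℤ_[p]) • a := (Nat.cast_smul_eq_nsmul _ _ _).symm
    _ = ((↑u⁻¹ : PowerSeries ℤ_[p]) * (m : PowerSeries ℤ_[p])) • (((p ^ j : ℕ) : PowerSeries ℤ_[p]) • a) := by
        rw [← hu, Units.inv_mul, one_smul]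
    _ = (↑u⁻¹ : PowerSeries ℤ_[p]) • (((p ^ j * m : ℕ) : PowerSeries ℤ_[p]) • a) := by
        rw [mul_smul, smul_smul (m : PowerSeries ℤ_[p]), Nat.cast_mul, mul_comm (m : PowerSeries ℤ_[p])]
    _ = 0 := by rw [h1, smul_zero]

/-- **Change of coefficients in `aeval` along `PowerSeries.map π`**: `π_*(P(y)) = (π P)(π_* y)` for `P ∈ 𝒪[Y]`, `y ∈ 𝒪⟦T⟧`.
[folklore] -/
theorem map_aeval_eq_aeval_map {𝒪 : Type*} [CommRing 𝒪] {k : Type*} [CommRing k] (π : 𝒪 →+* k)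
    (y : PowerSeries 𝒪) (P : Polynomial 𝒪) :
    PowerSeries.map π (Polynomial.aeval y P) = Polynomial.aeval (PowerSeries.map π y) (P.map π) := by
  rw [Polynomial.aeval_def, Polynomial.hom_eval₂, Polynomial.aeval_def, Polynomial.eval₂_map]
  congr 1
  ext x : 1
  simp only [RingHom.comp_apply, PowerSeries.algebraMap_apply, Algebra.algebraMap_self, RingHom.id_apply, PowerSeries.map_C]

/-- **`P((1+T)^N) ≠ 0` in `R⟦T⟧` for `P ∈ R[Y]` monic, `N ≥ 1`, `R` a domain**: it is the (monic) polynomial `P ∘ (Y+1)^N`.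
[folklore] -/
theorem aeval_one_add_X_pow_ne_zero {R : Type*} [CommRing R] [IsDomain R] {N : ℕ} (hN : 0 < N) {P : Polynomial R}
    (hP : P.Monic) : Polynomial.aeval (((1 : PowerSeries R) + PowerSeries.X) ^ N) P ≠ 0 := by
  set ι : Polynomial R →ₐ[R] PowerSeries R := Polynomial.coeToPowerSeries.algHom R with hι
  have hq : (Polynomial.X + Polynomial.C (1 : R)).Monic := Polynomial.monic_X_add_C 1
  have hιapp : ∀ φ : Polynomial R, ι φ = (φ : PowerSeries R) := fun φ => by
    rw [hι, Polynomial.coeToPowerSeries.algHom_apply, Algebra.algebraMap_self, PowerSeries.map_id, id_eq]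
  have hy : ((1 : PowerSeries R) + PowerSeries.X) ^ N = ι ((Polynomial.X + Polynomial.C (1 : R)) ^ N) := by
    rw [map_pow, hιapp, Polynomial.coe_add, Polynomial.coe_X, Polynomial.coe_C, map_one, add_comm]
  rw [hy, Polynomial.aeval_algHom_apply, ← Polynomial.comp_eq_aeval, hιapp, ne_eq, Polynomial.coe_eq_zero_iff]
  refine (hP.comp (hq.pow N) ?_).ne_zero
  rw [hq.natDegree_pow, Polynomial.natDegree_X_add_C, mul_one]
  exact hN.ne'

/-- **(hnd), generically**: if a ring map `π : 𝒪 → k` to a domain kills `c` but not `x`, then for monic `P_i ∈ 𝒪[Y]` and `N_i ≥ 1`,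
`C c ∤ C x · ∏_i P_i((1+T)^{N_i})` in `𝒪⟦T⟧` (reduce along `PowerSeries.map π`). At `(𝒪, c, x, π) = (ℤ_p⟦X⟧, X, p^a, constantCoeff)`
this is the non-divisibility input of `TelescopeK2ControlOfFrobeniusData.exists_quotSMulTop_XBig_linearMap_of_frobeniusData`. [folklore] -/
theorem not_C_dvd_C_mul_prod_aeval {𝒪 : Type*} [CommRing 𝒪] {k : Type*} [CommRing k] [IsDomain k] (π : 𝒪 →+* k)
    {c : 𝒪} (hc : π c = 0) {x : 𝒪} (hx : π x ≠ 0) {ι : Type*} (s : Finset ι) (N : ι → ℕ) (P : ι → Polynomial 𝒪)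
    (hN : ∀ i ∈ s, 0 < N i) (hP : ∀ i ∈ s, (P i).Monic) :
    ¬ ((PowerSeries.C c : PowerSeries 𝒪) ∣ (PowerSeries.C x : PowerSeries 𝒪) *
        ∏ i ∈ s, (Polynomial.aeval (((1 : PowerSeries 𝒪) + PowerSeries.X) ^ (N i)) (P i) : PowerSeries 𝒪)) := by
  classical
  rintro ⟨g, hg⟩
  have h0 : PowerSeries.map π ((PowerSeries.C c : PowerSeries 𝒪) * g) = 0 := by
    rw [map_mul, PowerSeries.map_C, hc, map_zero, zero_mul]
  rw [← hg, map_mul, map_prod] at h0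
  rcases mul_eq_zero.1 h0 with h1 | h2
  · rw [PowerSeries.map_C] at h1
    exact hx (by simpa using congrArg PowerSeries.constantCoeff h1)
  · obtain ⟨i, hi, hzero⟩ := Finset.prod_eq_zero_iff.1 h2
    rw [map_aeval_eq_aeval_map, map_pow, map_add, map_one, PowerSeries.map_X] at hzero
    exact aeval_one_add_X_pow_ne_zero (hN i hi) ((hP i hi).map π) hzero

/-- **The local image at a bad prime of degree one**: `K` imaginary quadratic, `κ` anticyclotomic, `w ∤ p` of residue degree one and
unramified over `ℚ`; then `κ(res_{K_w} d) = p^s` for some `d ∈ Γ_{K_w}` and `s` — `w` is finitely decomposed in `K_∞` (Brink) and a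
non-trivial closed subgroup of `ℤ_p` is `p^s ℤ_p`. [cite: Brink2007, Thm. 2 (pp. 2134–2135) and Cor. 1 (p. 2136)] [cite: Washington1997, §13.1] -/
theorem exists_localMap_inl_toAdd_eq_pow {K : Type} [Field K] [NumberField K] {p : ℕ} [Fact p.Prime]
    (hK : IsImaginaryQuadratic K) (κ : ZpExtension K p) (hκ : κ.IsAnticyclotomic) (w : HeightOneSpectrum (𝓞 K))
    (hpw : ((p : ℕ) : 𝓞 K) ∉ w.asIdeal) (he : w.asIdeal.ramificationIdx (𝓞 ℚ) = 1) (hf : w.asIdeal.inertiaDeg (𝓞 ℚ) = 1) :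
    ∃ (s : ℕ) (d : LocalGroup K (Sum.inl w)), (κ (localMap K (Sum.inl w) d)).toAdd = ((p ^ s : ℕ) : ℤ_[p]) := by
  have hnot : ¬ (GreenbergSelmer.decomp w ≤ κ.kerSubgroup) :=
    ZpExtension.decomp_not_le_kerSubgroup_of_isAnticyclotomic_anyPrime K p hK κ hκ w hpw he hf
  have hf' : ∃ τ : absoluteGaloisGroup (w.adicCompletion K),
      (κ.toContinuousMonoidHom.comp (absGaloisRestrict K (w.adicCompletion K))) τ ≠ 1 := by
    by_contra h
    push Not at h
    apply hnot
    rintro _ ⟨τ, rfl⟩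
    rw [ZpExtension.mem_kerSubgroup]
    exact h τ
  obtain ⟨s, hs⟩ := AnticyclotomicLocalImage.exists_forall_exists_toAdd_eq_pow_mul_of_ne_one _ hf'
  obtain ⟨τ, hτ⟩ := hs 1
  refine ⟨s, τ, ?_⟩
  rw [Nat.cast_pow, ← mul_one ((p : ℤ_[p]) ^ s)]
  exact hτ

/-! ## §2 W2's conclusion from N1-shaped data + (split) + (deg₁) + (ann) -/

/-- **SUB-LEAF W2 FROM FIBRE DATA + (split) + FROBENIUS ANNIHILATORS (no inertia clause).** See the module docstring. The proof is
this seat's `TelescopeK2ControlOfFrobeniusData.exists_quotSMulTop_XBig_linearMap_of_frobeniusData` at `(κ, ρ₂, 𝔭bar, ∅, c = X)` on the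
finset `S₁ = {w ∈ S₀ | w ∤ p}` with: (hroot)/(htor) as in p749092; (hfinK)/(hfin𝔭bar) by `TelescopeK2FixedTorsionFiniteSplitMult`;
(hsurj𝔭bar) by `AnticyclotomicLocalImage`; (hunr) off `S₁` from (unr) (`w ∣ p` never lies in the strict set); `d₀ w`, `N w = p^{s_w}` from
`exists_localMap_inl_toAdd_eq_pow` ((deg₁)); `P w` from (ann) at `d₀ w`; (hrootsI) because every element of `A₂` is `p`-primary; (hnd) by
`not_C_dvd_C_mul_prod_aeval` at `π = constantCoeff`.
[cite: JetchevSkinnerWan2017, §3.4, Lemma 3.4.1 (arXiv:1512.06894 p. 14)] [cite: Ochiai2006, Prop. 5.1 (Compositio 142 p. 1177)]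
[cite: Castella2018Erratum, Lemma 2.1 (p. 2)] [cite: Brink2007, Thm. 2 and Cor. 1 (pp. 2134–2136)] [cite: GreenbergVatsal2000, Prop. 2.4] -/
theorem exists_weightTwoControlMap_of_frobenius_of_split {K : Type} [Field K] [NumberField K] {p : ℕ} [Fact p.Prime]
    (W : WeierstrassCurve ℚ) [W.IsElliptic] (hK : IsImaginaryQuadratic K) (hp2 : p ≠ 2)
    (hsplit : W.HasSplitMultiplicativeReductionAtPrime p)
    (κ : ZpExtension K p) (hκ : κ.IsAnticyclotomic)
    (𝔭bar : HeightOneSpectrum (𝓞 K)) (h𝔭bar : ((p : ℕ) : 𝓞 K) ∈ 𝔭bar.asIdeal)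
    (he : 𝔭bar.asIdeal.ramificationIdx (𝓞 ℚ) = 1) (hf : 𝔭bar.asIdeal.inertiaDeg (𝓞 ℚ) = 1)
    [TopologicalSpace (PowerSeries ℤ_[p])] (A₂ : Type) [AddCommGroup A₂] [Module (PowerSeries ℤ_[p]) A₂]
    [TopologicalSpace A₂] [DiscreteTopology A₂]
    (ρ₂ : ContinuousRep (absoluteGaloisGroup K) (PowerSeries ℤ_[p]) A₂)
    [TopologicalSpace (PowerSeries (PowerSeries ℤ_[p]))]
    [ContinuousSMul (PowerSeries (PowerSeries ℤ_[p])) (BigRepModule (PowerSeries ℤ_[p]) p A₂)]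
    -- (tor), (cof₀), (unr), (fd₀) of N1's fibre data
    (htor : ∀ a : A₂, ∃ n : ℕ, (PowerSeries.X : PowerSeries ℤ_[p]) ^ n • a = 0)
    (hcof : ∀ a : A₂, ∃ b : A₂, (PowerSeries.X : PowerSeries ℤ_[p]) • b = a)
    (S₀ : Finset (HeightOneSpectrum (𝓞 K))) (hunr : GaloisRep.IsUnramifiedOutside (S₀ : Set (HeightOneSpectrum (𝓞 K))) ρ₂)
    (θ₀ : Submodule.torsionBy (PowerSeries ℤ_[p]) A₂ (PowerSeries.X : PowerSeries ℤ_[p]) →+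
      PrimaryTorsion (W.baseChange K).geomPoints p)
    (hθσ : ∀ (σ : absoluteGaloisGroup K)
      (a : Submodule.torsionBy (PowerSeries ℤ_[p]) A₂ (PowerSeries.X : PowerSeries ℤ_[p])),
      θ₀ (BigGaloisRep.torsionRep ρ₂ (PowerSeries.X : PowerSeries ℤ_[p]) σ a) =
        (W.baseChange K).primaryTorsionGaloisRep p σ (θ₀ a))
    (hker : Finite θ₀.ker)
    -- (deg₁): the bad primes away from `p` have degree one (Heegner)
    (hdeg : ∀ w ∈ S₀, ((p : ℕ) : 𝓞 K) ∉ w.asIdeal →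
      w.asIdeal.ramificationIdx (𝓞 ℚ) = 1 ∧ w.asIdeal.inertiaDeg (𝓞 ℚ) = 1)
    -- (ann): a monic annihilator of every `d ∈ Γ_{K_w}` on `A₂^{I_w}/X·A₂^{I_w}`
    (hann : ∀ w ∈ S₀, ((p : ℕ) : 𝓞 K) ∉ w.asIdeal → ∀ d : LocalGroup K (Sum.inl w),
      ∃ P : Polynomial (PowerSeries ℤ_[p]), P.Monic ∧
        ∀ a : A₂, (∀ h : LocalGroup K (Sum.inr w), ρ₂ (localMap K (Sum.inr w) h) a = a) →
          ∃ a₀ : A₂, (∀ h : LocalGroup K (Sum.inr w), ρ₂ (localMap K (Sum.inr w) h) a₀ = a₀) ∧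
            (PowerSeries.X : PowerSeries ℤ_[p]) • a₀ = (Polynomial.aeval (ρ₂ (localMap K (Sum.inl w) d)) P) a) :
    ∃ α : QuotSMulTop (PowerSeries.C (PowerSeries.X : PowerSeries ℤ_[p])) (XBig κ ρ₂ 𝔭bar (∅ : Set (HeightOneSpectrum (𝓞 K))))
        →ₗ[PowerSeries (PowerSeries ℤ_[p])]
        CharacterModule (TorsionControl.selmer (localMap K) (strictSet p 𝔭bar (∅ : Set (HeightOneSpectrum (𝓞 K))))
          (TorsionControl.torsionRep (AnticyclotomicBigGaloisRep κ ρ₂) (PowerSeries.C (PowerSeries.X : PowerSeries ℤ_[p])))),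
      (∀ m ∈ LinearMap.ker α, ∃ s : PowerSeries (PowerSeries ℤ_[p]),
        ¬ ((PowerSeries.C (PowerSeries.X : PowerSeries ℤ_[p])) ∣ s) ∧ s • m = 0) ∧
      Finite ((CharacterModule (TorsionControl.selmer (localMap K) (strictSet p 𝔭bar (∅ : Set (HeightOneSpectrum (𝓞 K))))
        (TorsionControl.torsionRep (AnticyclotomicBigGaloisRep κ ρ₂) (PowerSeries.C (PowerSeries.X : PowerSeries ℤ_[p]))))) ⧸
          LinearMap.range α) := by
  classical
  -- torsion and `p`-primarity of `A₂` from (tor) + (fd₀)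
  have hPT : ∀ e : PrimaryTorsion (W.baseChange K).geomPoints p, IsOfFinAddOrder e := fun e => by
    obtain ⟨k, hk⟩ := PrimaryTorsion.exists_pow_smul_eq_zero e
    refine (isOfFinAddOrder_iff_nsmul_eq_zero).2 ⟨p ^ k, pow_pos (Nat.Prime.pos Fact.out) k, ?_⟩
    apply PrimaryTorsion.ext
    rw [PrimaryTorsion.val_nsmul, hk, PrimaryTorsion.val_zero]
  have htors : ∀ a : A₂, IsOfFinAddOrder a :=
    TelescopeK2BigRepDivisible.isOfFinAddOrder_of_pow_torsion PowerSeries.X htor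
      (TelescopeK2BigRepDivisible.isOfFinAddOrder_of_torsionBy PowerSeries.X θ₀ hker hPT)
  have hprim : ∀ a : A₂, ∃ k : ℕ, p ^ k • a = 0 := fun a => exists_pow_smul_eq_zero_of_isOfFinAddOrder (htors a)
  have hroot : ∀ a : A₂, (∃ k : ℕ, p ^ k • a = 0) →
      ∃ b : A₂, (∃ k : ℕ, p ^ k • b = 0) ∧ (PowerSeries.X : PowerSeries ℤ_[p]) • b = a :=
    TelescopeK2BigRepDivisible.exists_primaryRoot_of_divisible PowerSeries.X hcof htors
  -- the open image at `𝔭bar` and the two finite fixed sets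
  obtain ⟨s, hsurj⟩ :=
    AnticyclotomicLocalImage.anticyclotomic_exists_forall_exists_toAdd_eq_pow_mul hK hp2 κ hκ 𝔭bar h𝔭bar
  have hfinloc := TelescopeK2FixedTorsionFiniteSplitMult.finite_fixed_torsionBy_local_of_splitMult W κ ρ₂ PowerSeries.X θ₀
    hp2 hsplit 𝔭bar h𝔭bar he hf hsurj hθσ hker
  have hfinK := TelescopeK2FixedTorsionFiniteSplitMult.finite_fixed_torsionBy_global_of_local κ ρ₂ PowerSeries.X 𝔭bar hfinloc
  -- the bad primes away from `p`, their Frobenius-type elements `d₀ w` with `κ(d₀ w) = p^{s_w} = N w`, and the annihilators `P w`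
  set S₁ : Finset (HeightOneSpectrum (𝓞 K)) := S₀.filter (fun w => ((p : ℕ) : 𝓞 K) ∉ w.asIdeal) with hS₁
  have hmem : ∀ w ∈ S₁, w ∈ S₀ ∧ ((p : ℕ) : 𝓞 K) ∉ w.asIdeal := fun w hw => Finset.mem_filter.1 hw
  have hd : ∀ w ∈ S₁, ∃ sd : ℕ × LocalGroup K (Sum.inl w),
      (κ (localMap K (Sum.inl w) sd.2)).toAdd = ((p ^ sd.1 : ℕ) : ℤ_[p]) := fun w hw => by
    obtain ⟨s', d, h⟩ := exists_localMap_inl_toAdd_eq_pow hK κ hκ w (hmem w hw).2 ((hdeg w (hmem w hw).1 (hmem w hw).2).1)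
      ((hdeg w (hmem w hw).1 (hmem w hw).2).2)
    exact ⟨(s', d), h⟩
  let d₀ : ∀ w : HeightOneSpectrum (𝓞 K), LocalGroup K (Sum.inl w) := fun w =>
    if hw : w ∈ S₁ then (Classical.choose (hd w hw)).2 else 1
  let N : HeightOneSpectrum (𝓞 K) → ℕ := fun w => if hw : w ∈ S₁ then p ^ (Classical.choose (hd w hw)).1 else 1
  have hN : ∀ w ∈ S₁, (κ (localMap K (Sum.inl w) (d₀ w))).toAdd = (N w : ℤ_[p]) := fun w hw => by
    simp only [d₀, N, dif_pos hw]
    exact Classical.choose_spec (hd w hw)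
  have hNpos : ∀ w ∈ S₁, 0 < N w := fun w hw => by
    simp only [N, dif_pos hw]
    exact pow_pos (Nat.Prime.pos Fact.out) _
  have hPex : ∀ w ∈ S₁, ∃ P : Polynomial (PowerSeries ℤ_[p]), P.Monic ∧
      ∀ a : A₂, (∀ h : LocalGroup K (Sum.inr w), ρ₂ (localMap K (Sum.inr w) h) a = a) →
        ∃ a₀ : A₂, (∀ h : LocalGroup K (Sum.inr w), ρ₂ (localMap K (Sum.inr w) h) a₀ = a₀) ∧
          (PowerSeries.X : PowerSeries ℤ_[p]) • a₀ = (Polynomial.aeval (ρ₂ (localMap K (Sum.inl w) (d₀ w))) P) a :=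
    fun w hw => hann w (hmem w hw).1 (hmem w hw).2 (d₀ w)
  let P : HeightOneSpectrum (𝓞 K) → Polynomial (PowerSeries ℤ_[p]) := fun w =>
    if hw : w ∈ S₁ then Classical.choose (hPex w hw) else Polynomial.X
  have hPmon : ∀ w ∈ S₁, (P w).Monic := fun w hw => by
    simp only [P, dif_pos hw]
    exact (Classical.choose_spec (hPex w hw)).1
  have hP : ∀ w ∈ S₁, ∀ a : A₂, (∀ h : LocalGroup K (Sum.inr w), ρ₂ (localMap K (Sum.inr w) h) a = a) →
      ∃ a₀ : A₂, (∀ h : LocalGroup K (Sum.inr w), ρ₂ (localMap K (Sum.inr w) h) a₀ = a₀) ∧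
        (PowerSeries.X : PowerSeries ℤ_[p]) • a₀ = (Polynomial.aeval (ρ₂ (localMap K (Sum.inl w) (d₀ w))) (P w)) a :=
    fun w hw => by
    simp only [P, dif_pos hw]
    exact (Classical.choose_spec (hPex w hw)).2
  refine TelescopeK2ControlOfFrobeniusData.exists_quotSMulTop_XBig_linearMap_of_frobeniusData κ ρ₂ 𝔭bar ∅
    PowerSeries.X (fun a _ => htor a) hroot hfinK hsurj hfinloc S₁ ?_ d₀ N hN P hP ?_ ?_
  · -- (hunr) off `S₁`: a strict-set index `Sum.inr w` has `w ∤ p`, so `w ∉ S₁ ⇒ w ∉ S₀ ⇒` unramified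
    intro w hw hstrict τ a
    have hpw : ((p : ℕ) : 𝓞 K) ∉ w.asIdeal := ((inr_mem_strictSet_iff p 𝔭bar w (∅ : Set (HeightOneSpectrum (𝓞 K)))).1 hstrict).2
    have hwS₀ : w ∉ (S₀ : Set (HeightOneSpectrum (𝓞 K))) := fun h =>
      hw (Finset.mem_filter.2 ⟨Finset.mem_coe.1 h, hpw⟩)
    exact TelescopeK2WeightTwoControlMapOfInert.apply_localMap_inr_eq_self_of_isUnramifiedAt ρ₂ (hunr w hwS₀) τ a
  · -- (hrootsI): every element of `A₂` is `p`-primary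
    rintro w - a - - ⟨a₀, ha₀, hc⟩
    exact ⟨a₀, ha₀, hprim a₀, hc⟩
  · -- (hnd): reduce modulo `X` (`constantCoeff : ℤ_p⟦X⟧ → ℤ_p`)
    intro a
    refine not_C_dvd_C_mul_prod_aeval (PowerSeries.constantCoeff (R := ℤ_[p])) PowerSeries.constantCoeff_X ?_ S₁ N P hNpos hPmon
    rw [map_pow, map_natCast]
    exact pow_ne_zero _ (Nat.cast_ne_zero.2 (Nat.Prime.ne_zero Fact.out))


/-! ## §3 The same on Cell C's Heegner field: (deg₁) discharged -/

/-- **SUB-LEAF W2 FROM FIBRE DATA + (split) + (ann) UNDER THE HEEGNER HYPOTHESIS**: as `exists_weightTwoControlMap_of_frobenius_of_split`,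
with (deg₁) discharged by the tree's `ramificationIdx_eq_one_and_inertiaDeg_eq_one_of_natCast_mem_of_satisfiesHeegnerHypothesis` from
`SatisfiesHeegnerHypothesis N₀ K` and «every bad prime away from `p` divides `N₀`» (`hS₀N`). Remaining non-FD inputs: (split), (ann).
[cite: Gross1991, §1 (the Heegner hypothesis)] [cite: Brink2007, Thm. 2 and Cor. 1 (pp. 2134–2136)]
[cite: JetchevSkinnerWan2017, §3.4, Lemma 3.4.1 (arXiv:1512.06894 p. 14)] [cite: Castella2018Erratum, Lemma 2.1 (p. 2)] -/
theorem exists_weightTwoControlMap_of_frobenius_of_heegner {K : Type} [Field K] [NumberField K] {p : ℕ} [Fact p.Prime]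
    (W : WeierstrassCurve ℚ) [W.IsElliptic] (hK : IsImaginaryQuadratic K) (hp2 : p ≠ 2)
    (hsplit : W.HasSplitMultiplicativeReductionAtPrime p)
    (κ : ZpExtension K p) (hκ : κ.IsAnticyclotomic)
    (𝔭bar : HeightOneSpectrum (𝓞 K)) (h𝔭bar : ((p : ℕ) : 𝓞 K) ∈ 𝔭bar.asIdeal)
    (he : 𝔭bar.asIdeal.ramificationIdx (𝓞 ℚ) = 1) (hf : 𝔭bar.asIdeal.inertiaDeg (𝓞 ℚ) = 1)
    [TopologicalSpace (PowerSeries ℤ_[p])] (A₂ : Type) [AddCommGroup A₂] [Module (PowerSeries ℤ_[p]) A₂]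
    [TopologicalSpace A₂] [DiscreteTopology A₂]
    (ρ₂ : ContinuousRep (absoluteGaloisGroup K) (PowerSeries ℤ_[p]) A₂)
    [TopologicalSpace (PowerSeries (PowerSeries ℤ_[p]))]
    [ContinuousSMul (PowerSeries (PowerSeries ℤ_[p])) (BigRepModule (PowerSeries ℤ_[p]) p A₂)]
    (htor : ∀ a : A₂, ∃ n : ℕ, (PowerSeries.X : PowerSeries ℤ_[p]) ^ n • a = 0)
    (hcof : ∀ a : A₂, ∃ b : A₂, (PowerSeries.X : PowerSeries ℤ_[p]) • b = a)
    (S₀ : Finset (HeightOneSpectrum (𝓞 K))) (hunr : GaloisRep.IsUnramifiedOutside (S₀ : Set (HeightOneSpectrum (𝓞 K))) ρ₂)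
    (θ₀ : Submodule.torsionBy (PowerSeries ℤ_[p]) A₂ (PowerSeries.X : PowerSeries ℤ_[p]) →+
      PrimaryTorsion (W.baseChange K).geomPoints p)
    (hθσ : ∀ (σ : absoluteGaloisGroup K)
      (a : Submodule.torsionBy (PowerSeries ℤ_[p]) A₂ (PowerSeries.X : PowerSeries ℤ_[p])),
      θ₀ (BigGaloisRep.torsionRep ρ₂ (PowerSeries.X : PowerSeries ℤ_[p]) σ a) =
        (W.baseChange K).primaryTorsionGaloisRep p σ (θ₀ a))
    (hker : Finite θ₀.ker)
    -- Heegner: `K` satisfies the Heegner hypothesis for `N₀ ≠ 0` and the bad primes away from `p` divide `N₀`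
    {N₀ : ℕ} (hN0 : N₀ ≠ 0) (hHeeg : SatisfiesHeegnerHypothesis N₀ K)
    (hS₀N : ∀ w ∈ S₀, ((p : ℕ) : 𝓞 K) ∉ w.asIdeal → ((N₀ : ℕ) : 𝓞 K) ∈ w.asIdeal)
    -- (ann)
    (hann : ∀ w ∈ S₀, ((p : ℕ) : 𝓞 K) ∉ w.asIdeal → ∀ d : LocalGroup K (Sum.inl w),
      ∃ P : Polynomial (PowerSeries ℤ_[p]), P.Monic ∧
        ∀ a : A₂, (∀ h : LocalGroup K (Sum.inr w), ρ₂ (localMap K (Sum.inr w) h) a = a) →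
          ∃ a₀ : A₂, (∀ h : LocalGroup K (Sum.inr w), ρ₂ (localMap K (Sum.inr w) h) a₀ = a₀) ∧
            (PowerSeries.X : PowerSeries ℤ_[p]) • a₀ = (Polynomial.aeval (ρ₂ (localMap K (Sum.inl w) d)) P) a) :
    ∃ α : QuotSMulTop (PowerSeries.C (PowerSeries.X : PowerSeries ℤ_[p])) (XBig κ ρ₂ 𝔭bar (∅ : Set (HeightOneSpectrum (𝓞 K))))
        →ₗ[PowerSeries (PowerSeries ℤ_[p])]
        CharacterModule (TorsionControl.selmer (localMap K) (strictSet p 𝔭bar (∅ : Set (HeightOneSpectrum (𝓞 K))))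
          (TorsionControl.torsionRep (AnticyclotomicBigGaloisRep κ ρ₂) (PowerSeries.C (PowerSeries.X : PowerSeries ℤ_[p])))),
      (∀ m ∈ LinearMap.ker α, ∃ s : PowerSeries (PowerSeries ℤ_[p]),
        ¬ ((PowerSeries.C (PowerSeries.X : PowerSeries ℤ_[p])) ∣ s) ∧ s • m = 0) ∧
      Finite ((CharacterModule (TorsionControl.selmer (localMap K) (strictSet p 𝔭bar (∅ : Set (HeightOneSpectrum (𝓞 K))))
        (TorsionControl.torsionRep (AnticyclotomicBigGaloisRep κ ρ₂) (PowerSeries.C (PowerSeries.X : PowerSeries ℤ_[p]))))) ⧸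
          LinearMap.range α) :=
  exists_weightTwoControlMap_of_frobenius_of_split W hK hp2 hsplit κ hκ 𝔭bar h𝔭bar he hf A₂ ρ₂ htor hcof S₀ hunr θ₀ hθσ hker
    (fun w hw hpw => ramificationIdx_eq_one_and_inertiaDeg_eq_one_of_natCast_mem_of_satisfiesHeegnerHypothesis hK.1 hHeeg hN0 w
      (hS₀N w hw hpw)) hann

end Summit.BirchSwinnertonDyer.BirchSwinnertonDyer.Theorems.TelescopeK2WeightTwoControlMapOfFrobenius

end
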